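import Literature.MathematicalPhysics.QuantumFieldTheory.Balaban1983to89.B3Op116Pieces
import Literature.MathematicalPhysics.QuantumFieldTheory.Balaban1983to89.B3Ineq210MixedRegularTorus

/-!
# Bałaban, *(Higgs)₂,₃ quantum fields in a finite volume III. Renormalization* [B3] — the operator (1.16) p. 414,
`[G_k(Ω,B)V_k(A,B)]^n G_k(Ω,A+B) [V_k(A,B)G_k(Ω,B)]^{n′}`: THE OPERATOR `V_k(A,B)` OF (I.3.16) IN SOURCE FORM on an arbitrary
region `Ω ⊆ T_ε` (THEOREM A, `opV_apply_eq_srcV`), and the resulting ROW / DERIVATIVE-ROW bounds of `T₀V_k(A,B)w` for every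
linear `T₀` (a propagator `G_k(Ω,X)` or one of its pieces) — the term bookkeeping of the kernel of (1.16), PROVED

statement-level skeleton of published theorems with citation tags; proofs where landed; nothing here is a claim about the Yang–Mills mass gap

T. Bałaban, Commun. Math. Phys. **88** (1983) 411–445 [cite: Balaban1983Higgs3]; part I, Commun. Math. Phys. **85** (1982) 603–636
[cite: Balaban1982Higgs1].  PDFs held: `paper:balaban1983-higgs-2-3-quantum-fields-finite-volume` (journal page = PDF page + 410;
p. 414 = `p0004.txt`), `paper:balaban1982-cmp85-higgs23-i` (journal page = PDF page + 602; p. 615 = `p0013.txt`).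

CITATION HEADER (lean-in-tree rule).  Cell `lit-balaban` (HOME `run/shared/lean/pub/lit-balaban/`), reader/typer seat **r14** gen 19
(unit `lit-balaban-r14`); TAKING line HOME/STATUS 2026-08-23T00:45:37Z (row owner r15: no objection, 00:48:57Z).  SKELETON row
**B3.Eq1.16 (analytic half)** (fold owner r15, `ROWS-B3.md`); decl of record `B3Sect2StatementsPart2.ScaledKernels.Ineq25At (n n' : ℕ)
(α δ₀ C : ℝ)` (r15, v1.2), clause (ii) — the kernel of (1.16).  Division of labour of record (HOME/STATUS 2026-08-23): FILE P
`B3Op116Pieces` (p40, landed: the bond multiplier `mulM`, `fTwo`/`fTwoAdj`, the weak form `siteInner_opV`); FILE E `B3Op116ScaleChains`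
(r14, landed: the scale sums); THIS FILE = FILE 3(a) (r14): the source form of `V_k(A,B)` and the row toolkit, general `Ω`; FILE 3(b)
`B3Op116KernelRegularTorus` (r14: the VALUE clause at `n = n′ = 1` on `T_ε`, then boxes); FILE 4 (p35: the derivative/Hölder clauses);
FILE 5 (p40: `norm116 ⇒ Ineq25At`).  USED BY NAME, never restated: p40's `B3Eq116TwoSidedExpansion.opV`/`op116`, `B3Op116Pieces.mulM`/
`fTwo`/`fTwoAdj`/`siteInner_opV`/`norm_mulM_le`/`norm_mulM_apply_le`/`norm_fTwoAdj_apply_le`/`norm_U_apply`, p40's dipole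
`B3Ineq210MixedRegularTorus.dip` with `siteInner_dip`/`dip_add`/`dip_smul`/`norm_dip_le`/`dip_eq_zero_of_ne`, `onb`, `cb_eq_single`,
`siteInner_single_right`, `norm_covDeriv_apply_single_le`, r14's `B3Ineq210RegularTorus.covDeriv_add''`/`covDeriv_smul''`/
`norm_avgQkAdj_apply'`, the symmetry `B1Eq230FluctCovPos.siteInner_propagatorK_comm`, the algebra of (I.1.5) `HiggsFluctMeasurePos.siteInner_*`,
the typer's `HiggsLattice`/`HiggsCovariance`/`HiggsCovariancePos.Inside`.

## What is printed

[B3] p. 414 [PDF 4] (verbatim): *"Finally if we expand the propagator G_k(Ω, A + B) using the formulas (I.3.44), (I.3.45), then in the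
last term of this expansion, equal to [G_k(Ω, B)V_k(A, B)]^n G_k(Ω, A + B) [V_k(A, B)G_k(Ω, B)]^{n′}, (1.16) we have the propagator
G_k(Ω, A + B). There are several possible ways of treating the above expression. Perhaps the simplest way is to treat it as an external
field, because for n, n′ sufficiently large, a kernel of the operator (1.16) is a sufficiently regular function of both variables. More
exactly the Hölder norms of the covariant derivatives of this kernel, the norms defined for example in the inequalities (I.2.24) and
(I.2.25) of Proposition I.2.1, are exponentially decaying with the distance of the arguments and are uniformly bounded by
O(1)(e(L^kε)^{1−α})^{n+n′}, where α > 0 but can be arbitrarily small. This estimate follows easily from the properties of the propagators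
G_k(Ω, A) proved in the next paper."*

[B1] p. 615 [PDF 13] (verbatim, the source of `V_k`): *"The above two formulas imply an expansion of the covariant Laplace operator with
the Neumann boundary conditions on arbitrary Ω"* — display (3.16): `−Δ^η_{A+B,Ω} + a_kP_k(A+B)` = `−Δ^η_{B,Ω} + a_kP_k(B)` + the
`F_{1,k}`-terms of the bonds `⊂ Ω` + *"a_kF_{2,k}(A,B)^*Q_k(B) + a_kQ_k^*(B)F_{2,k}(A,B) + a_kF_{2,k}(A,B)^*F_{2,k}(A,B). (3.16)"*;
`V_k(A,B)` is minus the difference (`B3Eq116TwoSidedExpansion.opV = H_k(Ω,B) − H_k(Ω,A+B)`, the mass terms cancel).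

## What this file proves, and how

THEOREM A (`opV_apply_eq_srcV`, §2): for every finite `Ω ⊆ T_ε`, all backgrounds `A` (the expanded one, print's `Ã`) and `B` (print's
`B̃`), all `k, m², a` and every field `w`,
`V_k(A,B)w = −Σ_{b⊂Ω}[δ_{b₊}·M_b^*(D^ε_Bw)(b) + ε^{−1}·dip_b(M_bw(b₊)) + δ_{b₊}·M_b^*M_bw(b₊)] − a_k(L^kε)^{−2}[F₂^*Q_k(B)w + Q_k^*(B)F₂w + F₂^*F₂w]`
(`srcV`), where `M_b = ε^{−1}U(ε,B_b)(U(ε,A_b) − 1)` is p40's bond multiplier of the split `D^ε_{A+B} = D^ε_B + M` ((I.3.14)), `M_b^*` its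
adjoint (`mulMT`), `dip_bY = δ_{b₊}·U(ε,B_b)^*Y − δ_{b₋}·Y = ε·D^{ε*}_B(δ_bY)` p40's dipole, `F₂ = Q_k(A+B) − Q_k(B)` ((I.3.15)).  Proof =
p40's weak form `siteInner_opV` + the four adjoint identities `⟨ψ, δ_yM^*X⟩ = ε^d⟨Mψ(y), X⟩`, `⟨ψ, dip_bY⟩ = ε^d·ε⟨(D^ε_Bψ)(b), Y⟩`,
`⟨ψ, F₂^*χ⟩ = ⟨F₂ψ, χ⟩`, `⟨ψ, Q^*χ⟩ = ⟨Qψ, χ⟩` + the non-degeneracy of (I.1.5) (`eq_of_siteInner_eq`).  `srcV` does not depend on `m²`.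
COROLLARIES (§3): (1.16) on a field is the nest `G_B·srcV(⋯G_{A+B}⋯srcV(G_Bφ))` (`op116_one_one_apply`, `op116_succ_left_apply`,
`op116_succ_right_apply`); through any linear `T` the sources separate (`map_srcV`).
THE ROW TOOLKIT (§4–§6), for `sup_b|A_b| ≤ s`: the sources are local with charges `≤ |e|s‖(D^ε_Bw)(b)‖`, `2|e|s‖w(b₊)‖`, `(|e|s)²‖w(b₊)‖`
(§4); through a vector-valued linear functional `T` every source is bounded by its charge times COLUMNS of `T` (`‖T(δ_yY)‖ ≤ ‖Y‖Σ_i‖Te_{(y,i)}‖`,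
`‖T(dip_bY)‖ ≤ ‖Y‖Σ_i‖T(dip_be_i)‖`, §5), whence (`norm_mapE_srcV_le`)
`‖T(V_k(A,B)w)‖ ≤ Σ_{b⊂Ω}[|e|s‖D^ε_Bw(b)‖κ_T(b₊) + ε^{−1}|e|s‖w(b₊)‖Σ_i‖T(dip_be_i)‖ + (|e|s)²‖w(b₊)‖κ_T(b₊)] + a_k(L^kε)^{−2}‖T(avgSrc w)‖`,
`κ_T(y) = Σ_i‖Te_{(y,i)}‖`; specialised (§6) to `T = ev_x ∘ T₀` (`norm_map_srcV_apply_le`: rows of `T₀V_k`), to `T = D^ε_B(·)(b′) ∘ T₀`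
(`norm_covDeriv_map_srcV_le`: derivative rows; there `ε^{−1}Σ_i‖D^ε_B(T₀dip_be_i)(b′)‖` is `ε^d`× p40's twice-differentiated
`mixedTerm` when `T₀` is a piece `G^η_{(j)}`), and to `T₀ = G_k(Ω,X)` with the dipole term in the SYMMETRIC form
`‖(G_k(Ω,X)dip_bY)(x)‖ ≤ ε‖Y‖Σ_i‖(D^ε_BG_k(Ω,X)e_{(x,i)})(b)‖` (`norm_propagatorK_dip_apply_le`: `siteInner_dip` + the symmetry of
`G_k`), so that NO `ε^{−1}` IS LEFT (`norm_propagatorK_srcV_apply_le`).  The averaging sources: `norm_mapE_avgSrc_le` (p40's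
`‖(F₂^*ψ)(y)‖ ≤ |e|sεd(L^k−1)‖ψ(y_k)‖`, `‖(Q^*ψ)(y)‖ = ‖ψ(y_k)‖`).  These are exactly the inputs FILE 3(b)/FILE 4 feed with (2.10)
(`B3Ineq210Regular*`, `B3Ineq210MixedRegular*`, piece by piece) and sum with FILE E.

## Honest scope

Exact identities and triangle-inequality bounds only: no decay, no scale sums, no smallness is used (FILE 3(b)/4/5).  `Ω` any finite
set of sites of `T_ε` (`V_k` and the propagators on the same `Ω`), arbitrary `A, B, m², a, k ≤ K` (only `norm_mapE_avgSrc_le` needs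
`k ≤ K` and `sup|A| ≤ s`), any `N, d, L`; print's `Ω` in (1.16) is a big-block region — a MODEL INSTANCE of this file's `Ω`, as are the
torus `Ω = T_ε` and the boxes of FILE 3(b).  The threshold of *"n, n′ sufficiently large"* is not touched here (announced for the cell:
VALUE clause `n, n′ ≥ 1` for `d ≤ 3`; derivative/Hölder clauses `n, n′ ≥ 2`).  No `def … : Prop`, no new named fact (`mulMT`, `srcMD`,
`srcDM`, `srcMM`, `bondSrc`, `avgSrc`, `srcV`, `dipLin`, `covDerivAt` are concrete definitions); axioms standard.  Value = the algebraic
skeleton of a located by-reference step of B3, NOT summit progress.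
-/

noncomputable section

open scoped BigOperators InnerProductSpace

namespace Literature.MathematicalPhysics.QuantumFieldTheory.Balaban1983to89.B3Op116SourceForm

open HiggsLattice (ChargeData ScalarField siteInner covDeriv)
open HiggsCovariance (propagatorK covOpK avgQkLin avgQkAdj E)
open HiggsCovariancePos (Inside)
open HiggsFluctMeasurePos (siteInner_comm siteInner_add_right siteInner_sub_right siteInner_smul_right
  siteInner_smul_left)
open HiggsFluctMeasureCov (siteInner_zero_right)
open B1Eq230FluctCov (Ix cb)
open B1Eq230FluctCovPos (siteInner_propagatorK_comm)
open B3Ineq210MixedRegularTorus (onb dip cb_eq_single siteInner_single_right sum_inner_single_left siteInner_dip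
  sum_inner_dip norm_apply_single_le norm_covDeriv_apply_single_le)
open B3Eq116TwoSidedExpansion (opV op116)
open B3Op116Pieces (mulM fTwo fTwoAdj siteInner_opV siteInner_fTwo norm_mulM_le norm_mulM_apply_le)

variable {P : HiggsLattice.Params} {N : ℕ}

/-! ## §1 Algebra of the scalar product (I.1.5): non-degeneracy, sums -/

section Algebra

variable {k : ℕ}

/-- **Non-degeneracy of (I.1.5)**: a field is determined by its scalar products against all fields (test with the one-site
fields `δ_yv`). [cite: Balaban1982Higgs1, (1.5) p.604] -/
theorem eq_of_siteInner_eq {f g : ScalarField P k N} (h : ∀ ψ : ScalarField P k N, siteInner ψ f = siteInner ψ g) :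
    f = g := by
  funext y
  refine ext_inner_right ℝ fun v => ?_
  have h1 := h (Pi.single y v)
  rw [siteInner_comm, siteInner_single_right, siteInner_comm, siteInner_single_right] at h1
  exact mul_left_cancel₀ (pow_pos (P.mesh_pos k) _).ne' h1

/-- (1.5) and negation in the second argument. [cite: Balaban1982Higgs1, (1.5) p.604] -/
theorem siteInner_neg_right (f g : ScalarField P k N) : siteInner f (-g) = -siteInner f g := by
  simp only [siteInner, Pi.neg_apply, inner_neg_right, mul_neg, Finset.sum_neg_distrib]

/-- (1.5) and finite sums in the second argument. [cite: Balaban1982Higgs1, (1.5) p.604] -/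
theorem siteInner_sum_right {ι : Type*} (s : Finset ι) (f : ScalarField P k N) (g : ι → ScalarField P k N) :
    siteInner f (∑ i ∈ s, g i) = ∑ i ∈ s, siteInner f (g i) := by
  classical
  induction s using Finset.induction_on with
  | empty => rw [Finset.sum_empty, Finset.sum_empty, siteInner_zero_right]
  | insert i s hi ih => rw [Finset.sum_insert hi, Finset.sum_insert hi, siteInner_add_right, ih]

/-- (1.5) against a conditional field. [cite: Balaban1982Higgs1, (1.5) p.604] -/
theorem siteInner_ite_right (p : Prop) [Decidable p] (f g : ScalarField P k N) :
    siteInner f (if p then g else 0) = if p then siteInner f g else 0 := by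
  split_ifs
  · rfl
  · exact siteInner_zero_right f

end Algebra

/-! ## §2 The sources of `V_k(A,B)` and THEOREM A -/

section Sources

variable (C : ChargeData N) (A B : HiggsLattice.VecField P 0)

/-- **`M_b^*`**, the adjoint of p40's bond multiplier `M_b = ε^{−1}U(ε,B_b)(U(ε,A_b) − 1)` of the split `D^ε_{A+B} = D^ε_B + M`
(the `F_{1,k}(A)^*`-type factor of (I.3.16)). [cite: Balaban1982Higgs1, (3.14) p.614, (3.16) p.615] -/
def mulMT (b : HiggsLattice.PBond P 0) : E N →L[ℝ] E N := ContinuousLinearMap.adjoint (mulM C A B b)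

/-- `⟨v, M_b^*X⟩ = ⟨M_bv, X⟩`. [cite: Balaban1982Higgs1, (3.16) p.615] -/
theorem inner_mulMT_right (b : HiggsLattice.PBond P 0) (v X : E N) : ⟪v, mulMT C A B b X⟫_ℝ = ⟪mulM C A B b v, X⟫_ℝ := by
  rw [mulMT, ContinuousLinearMap.adjoint_inner_right]

/-- `⟨M_b^*X, v⟩ = ⟨X, M_bv⟩`. [cite: Balaban1982Higgs1, (3.16) p.615] -/
theorem inner_mulMT_left (b : HiggsLattice.PBond P 0) (v X : E N) : ⟪mulMT C A B b X, v⟫_ℝ = ⟪X, mulM C A B b v⟫_ℝ := by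
  rw [mulMT, ContinuousLinearMap.adjoint_inner_left]

/-- `‖M_b^*‖ = ‖M_b‖`. [cite: Balaban1982Higgs1, (3.16) p.615] -/
theorem norm_mulMT (b : HiggsLattice.PBond P 0) : ‖mulMT C A B b‖ = ‖mulM C A B b‖ := by
  rw [mulMT, LinearIsometryEquiv.norm_map]

/-- **`‖M_b^*X‖ ≤ |e|·s·‖X‖`** when `|A_b| ≤ s` (p40's `‖M_b‖ ≤ |e||A_b|`). [cite: Balaban1982Higgs1, (3.14) p.614, (3.16) p.615] -/
theorem norm_mulMT_apply_le {s : ℝ} {b : HiggsLattice.PBond P 0} (hA : |A b| ≤ s) (X : E N) :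
    ‖mulMT C A B b X‖ ≤ |C.e| * s * ‖X‖ := by
  refine ((mulMT C A B b).le_opNorm X).trans ?_
  rw [norm_mulMT]
  exact mul_le_mul_of_nonneg_right ((norm_mulM_le C A B b).trans (mul_le_mul_of_nonneg_left hA (abs_nonneg _)))
    (norm_nonneg _)

/-- **The source of the term `M^*D` of (I.3.16)**: the one-site field `δ_{b₊}·M_b^*(D^ε_Bw)(b)`. [cite: Balaban1982Higgs1, (3.16) p.615] -/
def srcMD (b : HiggsLattice.PBond P 0) (w : ScalarField P 0 N) : ScalarField P 0 N :=
  Pi.single b.tgt (mulMT C A B b (covDeriv C B w b))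

/-- **The source of the term `D^*M` of (I.3.16)** (times `ε`): the dipole `dip_b(M_bw(b₊)) = ε·D^{ε*}_B(δ_b·M_bw(b₊))`. [cite: Balaban1982Higgs1, (3.16) p.615] -/
def srcDM (b : HiggsLattice.PBond P 0) (w : ScalarField P 0 N) : ScalarField P 0 N :=
  dip C B b (mulM C A B b (w b.tgt))

/-- **The source of the term `M^*M` of (I.3.16)**: the one-site field `δ_{b₊}·M_b^*M_bw(b₊)`. [cite: Balaban1982Higgs1, (3.16) p.615] -/
def srcMM (b : HiggsLattice.PBond P 0) (w : ScalarField P 0 N) : ScalarField P 0 N :=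
  Pi.single b.tgt (mulMT C A B b (mulM C A B b (w b.tgt)))

/-- The three sources of one bond `b ⊂ Ω`: `srcMD + ε^{−1}·srcDM + srcMM`. [cite: Balaban1982Higgs1, (3.16) p.615] -/
def bondSrc (b : HiggsLattice.PBond P 0) (w : ScalarField P 0 N) : ScalarField P 0 N :=
  srcMD C A B b w + (P.mesh 0)⁻¹ • srcDM C A B b w + srcMM C A B b w

variable (k : ℕ)

/-- **The averaging sources of (I.3.16)**: `F₂^*Q_k(B)w + Q_k^*(B)F₂w + F₂^*F₂w`, `F₂ = F_{2,k}(A,B) = Q_k(A+B) − Q_k(B)` (p40's `fTwo`,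
`fTwoAdj`). [cite: Balaban1982Higgs1, (3.16) p.615] -/
def avgSrc (w : ScalarField P 0 N) : ScalarField P 0 N :=
  fTwoAdj C A B k (avgQkLin C B k w) + avgQkAdj C B k (fTwo C A B k w) + fTwoAdj C A B k (fTwo C A B k w)

variable (Ω : Finset (HiggsLattice.Site P 0)) (a : ℝ)

/-- **`V_k(A,B)` IN SOURCE FORM**: `−Σ_{b⊂Ω} bondSrc_b w − a_k(L^kε)^{−2}·avgSrc w` (THEOREM A: this IS `opV … w`). [cite: Balaban1982Higgs1, (3.16) p.615] [cite: Balaban1983Higgs3, (1.16) p.414] -/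
def srcV (w : ScalarField P 0 N) : ScalarField P 0 N :=
  -(∑ b : HiggsLattice.PBond P 0, if Inside Ω b then bondSrc C A B b w else 0)
    - (B1.aSeq a P.L k * ((P.mesh k)⁻¹ ^ 2)) • avgSrc C A B k w

variable {Ω a k}

/-- `⟨ψ, srcMD_b w⟩ = ε^d⟨M_bψ(b₊), (D^ε_Bw)(b)⟩` — the first bond term of p40's weak form. [cite: Balaban1982Higgs1, (3.16) p.615] -/
theorem siteInner_srcMD (ψ w : ScalarField P 0 N) (b : HiggsLattice.PBond P 0) :
    siteInner ψ (srcMD C A B b w) = P.mesh 0 ^ P.d * ⟪mulM C A B b (ψ b.tgt), covDeriv C B w b⟫_ℝ := by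
  rw [srcMD, siteInner_single_right, inner_mulMT_right]

/-- `⟨ψ, srcDM_b w⟩ = ε^d·ε·⟨(D^ε_Bψ)(b), M_bw(b₊)⟩` — the second bond term (dipole identity `siteInner_dip`). [cite: Balaban1982Higgs1, (1.7) p.605, (3.16) p.615] -/
theorem siteInner_srcDM (ψ w : ScalarField P 0 N) (b : HiggsLattice.PBond P 0) :
    siteInner ψ (srcDM C A B b w) = P.mesh 0 ^ P.d * (P.mesh 0 * ⟪covDeriv C B ψ b, mulM C A B b (w b.tgt)⟫_ℝ) := by
  rw [srcDM, siteInner_comm, siteInner_dip, real_inner_comm]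

/-- `⟨ψ, srcMM_b w⟩ = ε^d⟨M_bψ(b₊), M_bw(b₊)⟩` — the third bond term. [cite: Balaban1982Higgs1, (3.16) p.615] -/
theorem siteInner_srcMM (ψ w : ScalarField P 0 N) (b : HiggsLattice.PBond P 0) :
    siteInner ψ (srcMM C A B b w) = P.mesh 0 ^ P.d * ⟪mulM C A B b (ψ b.tgt), mulM C A B b (w b.tgt)⟫_ℝ := by
  rw [srcMM, siteInner_single_right, inner_mulMT_right]

/-- `⟨ψ, bondSrc_b w⟩ = ε^d[⟨M_bψ(b₊), D^ε_Bw(b)⟩ + ⟨D^ε_Bψ(b), M_bw(b₊)⟩ + ⟨M_bψ(b₊), M_bw(b₊)⟩]` (the `ε^{−1}` of `bondSrc` cancels the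
`ε` of the dipole identity). [cite: Balaban1982Higgs1, (3.16) p.615] -/
theorem siteInner_bondSrc (ψ w : ScalarField P 0 N) (b : HiggsLattice.PBond P 0) :
    siteInner ψ (bondSrc C A B b w) = P.mesh 0 ^ P.d *
      (⟪mulM C A B b (ψ b.tgt), covDeriv C B w b⟫_ℝ + ⟪covDeriv C B ψ b, mulM C A B b (w b.tgt)⟫_ℝ
        + ⟪mulM C A B b (ψ b.tgt), mulM C A B b (w b.tgt)⟫_ℝ) := by
  rw [bondSrc, siteInner_add_right, siteInner_add_right, siteInner_smul_right, siteInner_srcMD, siteInner_srcDM,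
    siteInner_srcMM]
  have hε : P.mesh 0 ≠ 0 := (P.mesh_pos 0).ne'
  field_simp

/-- `⟨ψ, avgSrc w⟩ = ⟨F₂ψ, Q_k(B)w⟩ + ⟨Q_k(B)ψ, F₂w⟩ + ⟨F₂ψ, F₂w⟩` (adjointness of `F₂^*`, `Q_k^*` for (I.1.5): p40's `siteInner_fTwo`,
`HiggsCovariancePos.siteInner_avgQkLin`). [cite: Balaban1982Higgs1, (3.16) p.615] -/
theorem siteInner_avgSrc (ψ w : ScalarField P 0 N) :
    siteInner ψ (avgSrc C A B k w)
      = siteInner (fTwo C A B k ψ) (avgQkLin C B k w) + siteInner (avgQkLin C B k ψ) (fTwo C A B k w)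
          + siteInner (fTwo C A B k ψ) (fTwo C A B k w) := by
  rw [avgSrc, siteInner_add_right, siteInner_add_right, ← siteInner_fTwo, ← HiggsCovariancePos.siteInner_avgQkLin,
    ← siteInner_fTwo]

/-- **The weak forms agree**: `⟨ψ, srcV w⟩ = ⟨ψ, V_k(A,B)w⟩` for all `ψ` (p40's `siteInner_opV`). [cite: Balaban1982Higgs1, (3.16) p.615] [cite: Balaban1983Higgs3, (1.16) p.414] -/
theorem siteInner_srcV (msq : ℝ) (ψ w : ScalarField P 0 N) :
    siteInner ψ (srcV C A B k Ω a w) = siteInner ψ (opV C Ω A B msq a k w) := by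
  rw [siteInner_opV, srcV, siteInner_sub_right, siteInner_neg_right, siteInner_smul_right, siteInner_sum_right,
    siteInner_avgSrc]
  congr 2
  refine Finset.sum_congr rfl fun b _ => ?_
  rw [siteInner_ite_right]
  split_ifs with hb
  · exact siteInner_bondSrc C A B ψ w b
  · rfl

/-- **THEOREM A — `V_k(A,B)` in source form**:
`V_k(A,B)w = −Σ_{b⊂Ω}[δ_{b₊}M_b^*(D^ε_Bw)(b) + ε^{−1}dip_b(M_bw(b₊)) + δ_{b₊}M_b^*M_bw(b₊)] − a_k(L^kε)^{−2}[F₂^*Q_k(B)w + Q_k^*(B)F₂w + F₂^*F₂w]`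
on every region `Ω`, for all `A, B, k, m², a` — (I.3.16) as an operator identity on the carriers of record. [cite: Balaban1982Higgs1, (3.16) p.615] [cite: Balaban1983Higgs3, (1.16) p.414] -/
theorem opV_apply_eq_srcV (msq : ℝ) (w : ScalarField P 0 N) :
    opV C Ω A B msq a k w = srcV C A B k Ω a w :=
  eq_of_siteInner_eq fun ψ => (siteInner_srcV C A B msq ψ w).symm

end Sources

/-! ## §3 The operator (1.16) on a field; separation of the sources through a linear map -/

section Op116

variable (C : ChargeData N) (Ω : Finset (HiggsLattice.Site P 0)) (A B : HiggsLattice.VecField P 0) (msq a : ℝ) (k : ℕ)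

/-- **(1.16) at `n = n′ = 1` on a field**: `G_BV_kG_{A+B}V_kG_Bφ = G_B·srcV(G_{A+B}·srcV(G_Bφ))`. [cite: Balaban1983Higgs3, (1.16) p.414] -/
theorem op116_one_one_apply (φ : ScalarField P 0 N) :
    op116 C Ω A B msq a k 1 1 φ
      = propagatorK C Ω B msq a k (srcV C A B k Ω a
          (propagatorK C Ω (A + B) msq a k (srcV C A B k Ω a (propagatorK C Ω B msq a k φ)))) := by
  simp only [op116, pow_one, Module.End.mul_apply, opV_apply_eq_srcV]

/-- (1.16) at `n = n′ = 0` on a field is `G_k(Ω,A+B)φ`. [cite: Balaban1983Higgs3, (1.16) p.414] -/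
theorem op116_zero_zero_apply (φ : ScalarField P 0 N) :
    op116 C Ω A B msq a k 0 0 φ = propagatorK C Ω (A + B) msq a k φ := by
  rw [B3Eq116TwoSidedExpansion.op116_zero_zero]

/-- One more factor on the left: `(1.16)_{n+1,n′}φ = G_B·srcV((1.16)_{n,n′}φ)`. [cite: Balaban1983Higgs3, (1.16) p.414] -/
theorem op116_succ_left_apply (n n' : ℕ) (φ : ScalarField P 0 N) :
    op116 C Ω A B msq a k (n + 1) n' φ
      = propagatorK C Ω B msq a k (srcV C A B k Ω a (op116 C Ω A B msq a k n n' φ)) := by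
  rw [B3Eq116TwoSidedExpansion.op116_succ_left, Module.End.mul_apply, Module.End.mul_apply, opV_apply_eq_srcV]

/-- One more factor on the right: `(1.16)_{n,n′+1}φ = (1.16)_{n,n′}(srcV(G_Bφ))`. [cite: Balaban1983Higgs3, (1.16) p.414] -/
theorem op116_succ_right_apply (n n' : ℕ) (φ : ScalarField P 0 N) :
    op116 C Ω A B msq a k n (n' + 1) φ
      = op116 C Ω A B msq a k n n' (srcV C A B k Ω a (propagatorK C Ω B msq a k φ)) := by
  rw [B3Eq116TwoSidedExpansion.op116_succ_right, Module.End.mul_apply, Module.End.mul_apply, opV_apply_eq_srcV]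

variable {M' : Type*} [AddCommGroup M'] [Module ℝ M']

/-- **Separation of the sources** through any linear `T`:
`T(V_kw) = −Σ_{b⊂Ω}[T srcMD_b w + ε^{−1}T srcDM_b w + T srcMM_b w] − a_k(L^kε)^{−2}T(avgSrc w)`. [cite: Balaban1982Higgs1, (3.16) p.615] [cite: Balaban1983Higgs3, (1.16) p.414] -/
theorem map_srcV (T : ScalarField P 0 N →ₗ[ℝ] M') (w : ScalarField P 0 N) :
    T (srcV C A B k Ω a w)
      = -(∑ b : HiggsLattice.PBond P 0, if Inside Ω b then
            T (srcMD C A B b w) + (P.mesh 0)⁻¹ • T (srcDM C A B b w) + T (srcMM C A B b w) else 0)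
        - (B1.aSeq a P.L k * ((P.mesh k)⁻¹ ^ 2)) • T (avgSrc C A B k w) := by
  rw [srcV, map_sub, map_neg, map_smul, map_sum]
  congr 2
  refine Finset.sum_congr rfl fun b _ => ?_
  split_ifs
  · rw [bondSrc, map_add, map_add, map_smul]
  · exact map_zero T

end Op116

/-! ## §4 Locality and charges of the sources; the dipole through a propagator in the symmetric form -/

section Sizes

variable (C : ChargeData N) (A B : HiggsLattice.VecField P 0)

/-- `srcMD_b w` lives at `b₊`. [cite: Balaban1982Higgs1, (3.16) p.615] -/
theorem srcMD_apply_of_ne {b : HiggsLattice.PBond P 0} (w : ScalarField P 0 N) {y : HiggsLattice.Site P 0} (h : y ≠ b.tgt) :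
    srcMD C A B b w y = 0 := by
  rw [srcMD, Pi.single_eq_of_ne h]

/-- `srcMD_b w(b₊) = M_b^*(D^ε_Bw)(b)`. [cite: Balaban1982Higgs1, (3.16) p.615] -/
theorem srcMD_apply_tgt (b : HiggsLattice.PBond P 0) (w : ScalarField P 0 N) :
    srcMD C A B b w b.tgt = mulMT C A B b (covDeriv C B w b) := by
  rw [srcMD, Pi.single_eq_same]

/-- `srcMM_b w` lives at `b₊`. [cite: Balaban1982Higgs1, (3.16) p.615] -/
theorem srcMM_apply_of_ne {b : HiggsLattice.PBond P 0} (w : ScalarField P 0 N) {y : HiggsLattice.Site P 0} (h : y ≠ b.tgt) :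
    srcMM C A B b w y = 0 := by
  rw [srcMM, Pi.single_eq_of_ne h]

/-- `srcMM_b w(b₊) = M_b^*M_bw(b₊)`. [cite: Balaban1982Higgs1, (3.16) p.615] -/
theorem srcMM_apply_tgt (b : HiggsLattice.PBond P 0) (w : ScalarField P 0 N) :
    srcMM C A B b w b.tgt = mulMT C A B b (mulM C A B b (w b.tgt)) := by
  rw [srcMM, Pi.single_eq_same]

/-- `srcDM_b w` lives on the two ends of `b`. [cite: Balaban1982Higgs1, (1.7) p.605, (3.16) p.615] -/
theorem srcDM_apply_of_ne {b : HiggsLattice.PBond P 0} (w : ScalarField P 0 N) {y : HiggsLattice.Site P 0}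
    (h₁ : y ≠ b.src) (h₂ : y ≠ b.tgt) : srcDM C A B b w y = 0 := by
  rw [srcDM, B3Ineq210MixedRegularTorus.dip_eq_zero_of_ne b _ h₁ h₂]

/-- **Charge of `srcMD`**: `‖srcMD_b w(y)‖ ≤ |e|s‖(D^ε_Bw)(b)‖` for `|A_b| ≤ s`. [cite: Balaban1982Higgs1, (3.14) p.614, (3.16) p.615] -/
theorem norm_srcMD_apply_le {s : ℝ} {b : HiggsLattice.PBond P 0} (hA : |A b| ≤ s) (w : ScalarField P 0 N)
    (y : HiggsLattice.Site P 0) : ‖srcMD C A B b w y‖ ≤ |C.e| * s * ‖covDeriv C B w b‖ := by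
  by_cases h : y = b.tgt
  · rw [h, srcMD_apply_tgt]
    exact norm_mulMT_apply_le C A B hA _
  · rw [srcMD_apply_of_ne C A B w h, norm_zero]
    have hs : 0 ≤ s := (abs_nonneg _).trans hA
    positivity

/-- **Charge of `srcMM`**: `‖srcMM_b w(y)‖ ≤ (|e|s)²‖w(b₊)‖` for `|A_b| ≤ s`. [cite: Balaban1982Higgs1, (3.14) p.614, (3.16) p.615] -/
theorem norm_srcMM_apply_le {s : ℝ} {b : HiggsLattice.PBond P 0} (hA : |A b| ≤ s) (w : ScalarField P 0 N)
    (y : HiggsLattice.Site P 0) : ‖srcMM C A B b w y‖ ≤ (|C.e| * s) ^ 2 * ‖w b.tgt‖ := by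
  have hs : 0 ≤ s := (abs_nonneg _).trans hA
  by_cases h : y = b.tgt
  · rw [h, srcMM_apply_tgt]
    refine (norm_mulMT_apply_le C A B hA _).trans ?_
    rw [pow_two, mul_assoc (|C.e| * s)]
    exact mul_le_mul_of_nonneg_left (norm_mulM_apply_le C A B hA _) (by positivity)
  · rw [srcMM_apply_of_ne C A B w h, norm_zero]
    positivity

/-- **Charge of `srcDM`**: `‖srcDM_b w(y)‖ ≤ 2|e|s‖w(b₊)‖` for `|A_b| ≤ s` (p40's `norm_dip_le`). [cite: Balaban1982Higgs1, (1.7) p.605, (3.16) p.615] -/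
theorem norm_srcDM_apply_le {s : ℝ} {b : HiggsLattice.PBond P 0} (hA : |A b| ≤ s) (w : ScalarField P 0 N)
    (y : HiggsLattice.Site P 0) : ‖srcDM C A B b w y‖ ≤ 2 * (|C.e| * s * ‖w b.tgt‖) := by
  rw [srcDM]
  refine (B3Ineq210MixedRegularTorus.norm_dip_le b _ y).trans ?_
  exact mul_le_mul_of_nonneg_left (norm_mulM_apply_le C A B hA _) (by norm_num)

variable (Ω : Finset (HiggsLattice.Site P 0)) (X X' : HiggsLattice.VecField P 0) (msq a : ℝ) (k : ℕ)

/-- **The dipole through a propagator, by symmetry**: `⟨(G_k(Ω,X)dip_bY)(x), v⟩ = ε⟨Y, (D^ε_{X′}G_k(Ω,X)δ_xv)(b)⟩` for ALL regions `Ω`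
and backgrounds `X` (of `G_k`) and `X′` (of the dipole and the derivative) — p40's `inner_covDeriv_propagatorK_single` beyond the torus
(`siteInner_dip` + `B1Eq230FluctCovPos.siteInner_propagatorK_comm`). [cite: Balaban1982Higgs1, (1.7) p.605, (2.20) p.610] -/
theorem inner_propagatorK_dip_apply (b : HiggsLattice.PBond P 0) (Y v : E N) (x : HiggsLattice.Site P 0) :
    ⟪propagatorK C Ω X msq a k (dip C X' b Y) x, v⟫_ℝ
      = P.mesh 0 * ⟪Y, covDeriv C X' (propagatorK C Ω X msq a k (Pi.single x v)) b⟫_ℝ := by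
  have h1 := siteInner_dip (C := C) (A := X') b Y (propagatorK C Ω X msq a k (Pi.single x v))
  rw [siteInner_propagatorK_comm C Ω X msq a k, siteInner_comm, siteInner_single_right] at h1
  exact mul_left_cancel₀ (pow_pos (P.mesh_pos 0) _).ne' h1

/-- `⟨z, z⟩ ≤ ‖z‖·c`, `c ≥ 0` ⟹ `‖z‖ ≤ c`. [folklore] -/
private theorem norm_le_of_inner_self_le {z : E N} {c : ℝ} (hc : 0 ≤ c) (h : ⟪z, z⟫_ℝ ≤ ‖z‖ * c) : ‖z‖ ≤ c := by
  rw [real_inner_self_eq_norm_sq, pow_two] at h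
  by_cases hz0 : ‖z‖ = 0
  · rw [hz0]; exact hc
  · exact le_of_mul_le_mul_left h (lt_of_le_of_ne (norm_nonneg z) (Ne.symm hz0))

/-- **`‖(G_k(Ω,X)dip_bY)(x)‖ ≤ ε‖Y‖Σ_i‖(D^ε_{X′}G_k(Ω,X)e_{(x,i)})(b)‖`** — the column slice of `G_k(Ω,X)` on a dipole is `ε` times ONE
covariant derivative of the row `x` of `G_k(Ω,X)` (symmetry; p40's `norm_covDeriv_apply_single_le`). [cite: Balaban1982Higgs1, (1.7) p.605, (2.20) p.610] -/
theorem norm_propagatorK_dip_apply_le (b : HiggsLattice.PBond P 0) (Y : E N) (x : HiggsLattice.Site P 0) :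
    ‖propagatorK C Ω X msq a k (dip C X' b Y) x‖
      ≤ P.mesh 0 * ‖Y‖ * ∑ i : Ix N, ‖covDeriv C X' (propagatorK C Ω X msq a k (cb P N 0 (x, i))) b‖ := by
  have hS0 : 0 ≤ ∑ i : Ix N, ‖covDeriv C X' (propagatorK C Ω X msq a k (cb P N 0 (x, i))) b‖ :=
    Finset.sum_nonneg fun _ _ => norm_nonneg _
  have hε : 0 < P.mesh 0 := P.mesh_pos 0
  refine norm_le_of_inner_self_le (by positivity) ?_
  rw [inner_propagatorK_dip_apply]
  calc P.mesh 0 * ⟪Y, covDeriv C X' (propagatorK C Ω X msq a k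
          (Pi.single x (propagatorK C Ω X msq a k (dip C X' b Y) x))) b⟫_ℝ
      ≤ P.mesh 0 * (‖Y‖ * ‖covDeriv C X' (propagatorK C Ω X msq a k
          (Pi.single x (propagatorK C Ω X msq a k (dip C X' b Y) x))) b‖) :=
        mul_le_mul_of_nonneg_left (real_inner_le_norm _ _) hε.le
    _ ≤ P.mesh 0 * (‖Y‖ * (‖propagatorK C Ω X msq a k (dip C X' b Y) x‖
          * ∑ i : Ix N, ‖covDeriv C X' (propagatorK C Ω X msq a k (cb P N 0 (x, i))) b‖)) :=
        mul_le_mul_of_nonneg_left (mul_le_mul_of_nonneg_left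
          (norm_covDeriv_apply_single_le C X' (propagatorK C Ω X msq a k) x _ b) (norm_nonneg _)) hε.le
    _ = _ := by ring

/-- **The `D^*M` source through a propagator carries NO `ε^{−1}`**:
`ε^{−1}‖(G_k(Ω,X)srcDM_b w)(x)‖ ≤ |e|s‖w(b₊)‖Σ_i‖(D^ε_BG_k(Ω,X)e_{(x,i)})(b)‖` for `|A_b| ≤ s`. [cite: Balaban1982Higgs1, (1.7) p.605, (3.16) p.615] -/
theorem norm_propagatorK_srcDM_apply_le {s : ℝ} {b : HiggsLattice.PBond P 0} (hA : |A b| ≤ s) (w : ScalarField P 0 N)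
    (x : HiggsLattice.Site P 0) :
    (P.mesh 0)⁻¹ * ‖propagatorK C Ω X msq a k (srcDM C A B b w) x‖
      ≤ |C.e| * s * ‖w b.tgt‖ * ∑ i : Ix N, ‖covDeriv C B (propagatorK C Ω X msq a k (cb P N 0 (x, i))) b‖ := by
  have hε : P.mesh 0 ≠ 0 := (P.mesh_pos 0).ne'
  rw [srcDM]
  refine (mul_le_mul_of_nonneg_left (norm_propagatorK_dip_apply_le C Ω X B msq a k b _ x)
    (inv_nonneg.mpr (P.mesh_pos 0).le)).trans ?_
  rw [← mul_assoc, ← mul_assoc, inv_mul_cancel₀ hε, one_mul]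
  exact mul_le_mul_of_nonneg_right (norm_mulM_apply_le C A B hA _) (Finset.sum_nonneg fun _ _ => norm_nonneg _)

end Sizes

/-! ## §5 The sources through a vector-valued linear functional: charges × columns -/

section Functional

variable (C : ChargeData N) (A B : HiggsLattice.VecField P 0)
variable {M' : Type*} [NormedAddCommGroup M'] [NormedSpace ℝ M']

/-- `‖SY‖ ≤ ‖Y‖Σ_i‖Se_i‖` for a linear map out of `ℝ^N` (expansion in the orthonormal basis `e_i`). [cite: Balaban1982Higgs1, (1.5) p.604] -/
theorem norm_apply_le_norm_mul_sum_onb (S : E N →ₗ[ℝ] M') (Y : E N) :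
    ‖S Y‖ ≤ ‖Y‖ * ∑ i : Ix N, ‖S (onb N i)‖ := by
  have hY : Y = ∑ i : Ix N, (stdOrthonormalBasis ℝ (E N)).repr Y i • onb N i := by
    unfold onb; rw [(stdOrthonormalBasis ℝ (E N)).sum_repr Y]
  conv_lhs => rw [hY]
  rw [map_sum, Finset.mul_sum]
  refine (norm_sum_le _ _).trans (Finset.sum_le_sum fun i _ => ?_)
  rw [map_smul, norm_smul, Real.norm_eq_abs]
  refine mul_le_mul_of_nonneg_right ?_ (norm_nonneg _)
  rw [← Real.norm_eq_abs, ← (stdOrthonormalBasis ℝ (E N)).repr.norm_map Y]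
  exact PiLp.norm_apply_le _ i

/-- **One-site source through `T`**: `‖T(δ_yY)‖ ≤ ‖Y‖Σ_i‖Te_{(y,i)}‖` (`e_{(y,i)} = δ_ye_i`, p40's `cb_eq_single`). [cite: Balaban1982Higgs1, (1.5) p.604] -/
theorem norm_mapE_single_le (T : ScalarField P 0 N →ₗ[ℝ] M') (y : HiggsLattice.Site P 0) (Y : E N) :
    ‖T (Pi.single y Y)‖ ≤ ‖Y‖ * ∑ i : Ix N, ‖T (cb P N 0 (y, i))‖ := by
  have h := norm_apply_le_norm_mul_sum_onb (T ∘ₗ LinearMap.single ℝ (fun _ : HiggsLattice.Site P 0 => E N) y) Y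
  simp only [LinearMap.coe_comp, Function.comp_apply, LinearMap.coe_single] at h
  refine h.trans (le_of_eq ?_)
  congr 1
  refine Finset.sum_congr rfl fun i _ => ?_
  rw [cb_eq_single]

/-- p40's dipole `dip_b` as a linear map of its charge `Y ∈ ℝ^N` (`dip_add`, `dip_smul`). [cite: Balaban1982Higgs1, (1.7) p.605] -/
def dipLin (b : HiggsLattice.PBond P 0) : E N →ₗ[ℝ] ScalarField P 0 N where
  toFun := dip C B b
  map_add' := B3Ineq210MixedRegularTorus.dip_add b
  map_smul' := B3Ineq210MixedRegularTorus.dip_smul b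

/-- `dipLin_b Y = dip_b Y`. [cite: Balaban1982Higgs1, (1.7) p.605] -/
@[simp] theorem dipLin_apply (b : HiggsLattice.PBond P 0) (Y : E N) : dipLin C B b Y = dip C B b Y := rfl

/-- **Dipole source through `T`**: `‖T(dip_bY)‖ ≤ ‖Y‖Σ_i‖T(dip_be_i)‖`. [cite: Balaban1982Higgs1, (1.7) p.605] -/
theorem norm_mapE_dip_le (T : ScalarField P 0 N →ₗ[ℝ] M') (b : HiggsLattice.PBond P 0) (Y : E N) :
    ‖T (dip C B b Y)‖ ≤ ‖Y‖ * ∑ i : Ix N, ‖T (dip C B b (onb N i))‖ := by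
  have h := norm_apply_le_norm_mul_sum_onb (T ∘ₗ dipLin C B b) Y
  simpa only [LinearMap.coe_comp, Function.comp_apply, dipLin_apply] using h

/-- **A field through `T`, site by site**: `‖Tf‖ ≤ Σ_y‖f(y)‖·Σ_i‖Te_{(y,i)}‖` (`f = Σ_yδ_yf(y)`). [cite: Balaban1982Higgs1, (1.5) p.604] -/
theorem norm_mapE_le_sum_norm_mul_col (T : ScalarField P 0 N →ₗ[ℝ] M') (f : ScalarField P 0 N) :
    ‖T f‖ ≤ ∑ y : HiggsLattice.Site P 0, ‖f y‖ * ∑ i : Ix N, ‖T (cb P N 0 (y, i))‖ := by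
  conv_lhs => rw [← Finset.univ_sum_single f]
  rw [map_sum]
  exact (norm_sum_le _ _).trans (Finset.sum_le_sum fun y _ => norm_mapE_single_le T y (f y))

/-- `‖T(srcMD_b w)‖ ≤ |e|s‖(D^ε_Bw)(b)‖·Σ_i‖Te_{(b₊,i)}‖` for `|A_b| ≤ s`. [cite: Balaban1982Higgs1, (3.16) p.615] -/
theorem norm_mapE_srcMD_le (T : ScalarField P 0 N →ₗ[ℝ] M') {s : ℝ} {b : HiggsLattice.PBond P 0} (hA : |A b| ≤ s)
    (w : ScalarField P 0 N) :
    ‖T (srcMD C A B b w)‖ ≤ |C.e| * s * ‖covDeriv C B w b‖ * ∑ i : Ix N, ‖T (cb P N 0 (b.tgt, i))‖ := by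
  rw [srcMD]
  refine (norm_mapE_single_le T b.tgt _).trans ?_
  exact mul_le_mul_of_nonneg_right (norm_mulMT_apply_le C A B hA _) (Finset.sum_nonneg fun _ _ => norm_nonneg _)

/-- `‖T(srcMM_b w)‖ ≤ (|e|s)²‖w(b₊)‖·Σ_i‖Te_{(b₊,i)}‖` for `|A_b| ≤ s`. [cite: Balaban1982Higgs1, (3.16) p.615] -/
theorem norm_mapE_srcMM_le (T : ScalarField P 0 N →ₗ[ℝ] M') {s : ℝ} {b : HiggsLattice.PBond P 0} (hA : |A b| ≤ s)
    (w : ScalarField P 0 N) :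
    ‖T (srcMM C A B b w)‖ ≤ (|C.e| * s) ^ 2 * ‖w b.tgt‖ * ∑ i : Ix N, ‖T (cb P N 0 (b.tgt, i))‖ := by
  rw [srcMM]
  refine (norm_mapE_single_le T b.tgt _).trans (mul_le_mul_of_nonneg_right ?_ (Finset.sum_nonneg fun _ _ => norm_nonneg _))
  rw [← srcMM_apply_tgt]
  exact norm_srcMM_apply_le C A B hA w b.tgt

/-- `‖T(srcDM_b w)‖ ≤ |e|s‖w(b₊)‖·Σ_i‖T(dip_be_i)‖` for `|A_b| ≤ s`. [cite: Balaban1982Higgs1, (1.7) p.605, (3.16) p.615] -/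
theorem norm_mapE_srcDM_le (T : ScalarField P 0 N →ₗ[ℝ] M') {s : ℝ} {b : HiggsLattice.PBond P 0} (hA : |A b| ≤ s)
    (w : ScalarField P 0 N) :
    ‖T (srcDM C A B b w)‖ ≤ |C.e| * s * ‖w b.tgt‖ * ∑ i : Ix N, ‖T (dip C B b (onb N i))‖ := by
  rw [srcDM]
  refine (norm_mapE_dip_le C B T b _).trans ?_
  exact mul_le_mul_of_nonneg_right (norm_mulM_apply_le C A B hA _) (Finset.sum_nonneg fun _ _ => norm_nonneg _)

variable (k : ℕ)

/-- **The averaging sources through `T`**: with `m = |e|sεd(L^k−1)` (p40's `norm_fTwoAdj_apply_le`; `‖(Q_k^*ψ)(y)‖ = ‖ψ(y_k)‖`),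
`‖T(avgSrc w)‖ ≤ Σ_y[m‖(Q_k(B)w)(y_k)‖ + ‖(F₂w)(y_k)‖ + m‖(F₂w)(y_k)‖]·Σ_i‖Te_{(y,i)}‖`, `k ≤ K`, `sup_b|A_b| ≤ s`. [cite: Balaban1982Higgs1, (3.15) p.614, (3.16) p.615] -/
theorem norm_mapE_avgSrc_le (T : ScalarField P 0 N →ₗ[ℝ] M') (hk : k ≤ P.K) {s : ℝ} (hs : 0 ≤ s)
    (hA : ∀ b : HiggsLattice.PBond P 0, |A b| ≤ s) (w : ScalarField P 0 N) :
    ‖T (avgSrc C A B k w)‖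
      ≤ ∑ y : HiggsLattice.Site P 0,
          (|C.e| * s * P.mesh 0 * (P.d * ((P.L : ℝ) ^ k - 1)) * ‖avgQkLin C B k w (HiggsAveraging.blockIter k y)‖
            + ‖fTwo C A B k w (HiggsAveraging.blockIter k y)‖
            + |C.e| * s * P.mesh 0 * (P.d * ((P.L : ℝ) ^ k - 1)) * ‖fTwo C A B k w (HiggsAveraging.blockIter k y)‖)
          * ∑ i : Ix N, ‖T (cb P N 0 (y, i))‖ := by
  refine (norm_mapE_le_sum_norm_mul_col T _).trans (Finset.sum_le_sum fun y _ => ?_)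
  refine mul_le_mul_of_nonneg_right ?_ (Finset.sum_nonneg fun _ _ => norm_nonneg _)
  rw [avgSrc, Pi.add_apply, Pi.add_apply]
  refine (norm_add_le _ _).trans (add_le_add ((norm_add_le _ _).trans (add_le_add ?_ ?_)) ?_)
  · exact B3Op116Pieces.norm_fTwoAdj_apply_le C A B k hk hs hA _ y
  · rw [B3Ineq210RegularTorus.norm_avgQkAdj_apply']
  · exact B3Op116Pieces.norm_fTwoAdj_apply_le C A B k hk hs hA _ y

variable (Ω : Finset (HiggsLattice.Site P 0)) (a : ℝ)

/-- **`V_k(A,B)w` THROUGH A VECTOR-VALUED LINEAR FUNCTIONAL `T`** (`sup_b|A_b| ≤ s`):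
`‖T(V_kw)‖ ≤ Σ_{b⊂Ω}[|e|s‖D^ε_Bw(b)‖κ_T(b₊) + ε^{−1}|e|s‖w(b₊)‖Σ_i‖T(dip_be_i)‖ + (|e|s)²‖w(b₊)‖κ_T(b₊)] + |a_k|(L^kε)^{−2}‖T(avgSrc w)‖`,
`κ_T(y) = Σ_i‖Te_{(y,i)}‖` (with THEOREM A, `T(V_kw) = T(srcV w)`). [cite: Balaban1982Higgs1, (3.16) p.615] [cite: Balaban1983Higgs3, (1.16) p.414] -/
theorem norm_mapE_srcV_le (T : ScalarField P 0 N →ₗ[ℝ] M') {s : ℝ} (hA : ∀ b : HiggsLattice.PBond P 0, |A b| ≤ s)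
    (w : ScalarField P 0 N) :
    ‖T (srcV C A B k Ω a w)‖
      ≤ (∑ b : HiggsLattice.PBond P 0, if Inside Ω b then
            |C.e| * s * ‖covDeriv C B w b‖ * (∑ i : Ix N, ‖T (cb P N 0 (b.tgt, i))‖)
              + (P.mesh 0)⁻¹ * (|C.e| * s * ‖w b.tgt‖ * ∑ i : Ix N, ‖T (dip C B b (onb N i))‖)
              + (|C.e| * s) ^ 2 * ‖w b.tgt‖ * (∑ i : Ix N, ‖T (cb P N 0 (b.tgt, i))‖) else 0)
        + |B1.aSeq a P.L k| * (P.mesh k)⁻¹ ^ 2 * ‖T (avgSrc C A B k w)‖ := by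
  rw [map_srcV]
  refine (norm_sub_le _ _).trans (add_le_add ?_ ?_)
  · rw [norm_neg]
    refine (norm_sum_le _ _).trans (Finset.sum_le_sum fun b _ => ?_)
    split_ifs
    · refine (norm_add_le _ _).trans (add_le_add ((norm_add_le _ _).trans (add_le_add ?_ ?_)) ?_)
      · exact norm_mapE_srcMD_le C A B T (hA b) w
      · rw [norm_smul, Real.norm_eq_abs, abs_of_pos (inv_pos.mpr (P.mesh_pos 0))]
        exact mul_le_mul_of_nonneg_left (norm_mapE_srcDM_le C A B T (hA b) w) (inv_nonneg.mpr (P.mesh_pos 0).le)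
      · exact norm_mapE_srcMM_le C A B T (hA b) w
    · rw [norm_zero]
  · rw [norm_smul, Real.norm_eq_abs, abs_mul, abs_of_nonneg (pow_nonneg (inv_nonneg.mpr (P.mesh_pos k).le) 2)]

/-- The covariant derivative (I.1.7) at one bond, as a linear functional of the field (r14's `covDeriv_add''`, `covDeriv_smul''`). [cite: Balaban1982Higgs1, (1.7) p.605] -/
def covDerivAt (X : HiggsLattice.VecField P 0) (b : HiggsLattice.PBond P 0) : ScalarField P 0 N →ₗ[ℝ] E N where
  toFun φ := covDeriv C X φ b
  map_add' u v := B3Ineq210RegularTorus.covDeriv_add'' C X u v b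
  map_smul' c u := B3Ineq210RegularTorus.covDeriv_smul'' C X c u b

/-- `covDerivAt_b φ = (D^ε_Xφ)(b)`. [cite: Balaban1982Higgs1, (1.7) p.605] -/
@[simp] theorem covDerivAt_apply (X : HiggsLattice.VecField P 0) (b : HiggsLattice.PBond P 0) (φ : ScalarField P 0 N) :
    covDerivAt C X b φ = covDeriv C X φ b := rfl

end Functional

/-! ## §6 Rows and derivative rows of `T₀V_k(A,B)`; the propagator row without `ε^{−1}` -/

section Rows

variable (C : ChargeData N) (Ω : Finset (HiggsLattice.Site P 0)) (A B : HiggsLattice.VecField P 0) (a : ℝ) (k : ℕ)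

/-- **ROW of `T₀V_k(A,B)`** at a site `x`, for any linear `T₀` from the fields on `T_ε` to the fields on `T^{(j)}` (a propagator, a piece
`G^η_{(j)}`, `Q_jG_j`, …): `norm_mapE_srcV_le` with `T = ev_x ∘ T₀`. [cite: Balaban1982Higgs1, (3.16) p.615] [cite: Balaban1983Higgs3, (1.16) p.414] -/
theorem norm_map_srcV_apply_le {j : ℕ} (T₀ : ScalarField P 0 N →ₗ[ℝ] ScalarField P j N) {s : ℝ}
    (hA : ∀ b : HiggsLattice.PBond P 0, |A b| ≤ s) (w : ScalarField P 0 N) (x : HiggsLattice.Site P j) :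
    ‖T₀ (srcV C A B k Ω a w) x‖
      ≤ (∑ b : HiggsLattice.PBond P 0, if Inside Ω b then
            |C.e| * s * ‖covDeriv C B w b‖ * (∑ i : Ix N, ‖T₀ (cb P N 0 (b.tgt, i)) x‖)
              + (P.mesh 0)⁻¹ * (|C.e| * s * ‖w b.tgt‖ * ∑ i : Ix N, ‖T₀ (dip C B b (onb N i)) x‖)
              + (|C.e| * s) ^ 2 * ‖w b.tgt‖ * (∑ i : Ix N, ‖T₀ (cb P N 0 (b.tgt, i)) x‖) else 0)
        + |B1.aSeq a P.L k| * (P.mesh k)⁻¹ ^ 2 * ‖T₀ (avgSrc C A B k w) x‖ := by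
  simpa only [LinearMap.coe_comp, Function.comp_apply, LinearMap.coe_proj, Function.eval] using
    norm_mapE_srcV_le C A B k Ω a (LinearMap.proj x ∘ₗ T₀) hA w

/-- **DERIVATIVE ROW `(D^ε_BT₀V_k(A,B)w)(b′)`** for any linear `T₀` on the fields on `T_ε`: `norm_mapE_srcV_le` with `T = D^ε_B(·)(b′) ∘ T₀`; the
dipole entry `ε^{−1}Σ_i‖(D^ε_BT₀dip_be_i)(b′)‖` is `ε^d`× p40's twice-differentiated `mixedTerm` when `T₀ = G^η_{(j)}`. [cite: Balaban1982Higgs1, (3.16) p.615] [cite: Balaban1983Higgs3, (1.16) p.414, (2.10) p.426] -/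
theorem norm_covDeriv_map_srcV_le (T₀ : ScalarField P 0 N →ₗ[ℝ] ScalarField P 0 N) {s : ℝ}
    (hA : ∀ b : HiggsLattice.PBond P 0, |A b| ≤ s) (w : ScalarField P 0 N) (b' : HiggsLattice.PBond P 0) :
    ‖covDeriv C B (T₀ (srcV C A B k Ω a w)) b'‖
      ≤ (∑ b : HiggsLattice.PBond P 0, if Inside Ω b then
            |C.e| * s * ‖covDeriv C B w b‖ * (∑ i : Ix N, ‖covDeriv C B (T₀ (cb P N 0 (b.tgt, i))) b'‖)
              + (P.mesh 0)⁻¹ * (|C.e| * s * ‖w b.tgt‖ * ∑ i : Ix N, ‖covDeriv C B (T₀ (dip C B b (onb N i))) b'‖)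
              + (|C.e| * s) ^ 2 * ‖w b.tgt‖ * (∑ i : Ix N, ‖covDeriv C B (T₀ (cb P N 0 (b.tgt, i))) b'‖) else 0)
        + |B1.aSeq a P.L k| * (P.mesh k)⁻¹ ^ 2 * ‖covDeriv C B (T₀ (avgSrc C A B k w)) b'‖ := by
  simpa only [LinearMap.coe_comp, Function.comp_apply, covDerivAt_apply] using
    norm_mapE_srcV_le C A B k Ω a (covDerivAt C B b' ∘ₗ T₀) hA w

variable (X : HiggsLattice.VecField P 0) (msq : ℝ)

/-- **ROW OF A PROPAGATOR ON `V_k(A,B)`, NO `ε^{−1}` LEFT**: for `sup_b|A_b| ≤ s`, every region `Ω`, backgrounds `X` (of `G_k`), `A, B`,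
`‖(G_k(Ω,X)V_k(A,B)w)(x)‖ ≤ Σ_{b⊂Ω}[|e|s‖D^ε_Bw(b)‖κ(x,b₊) + |e|s‖w(b₊)‖Σ_i‖(D^ε_BG_k(Ω,X)e_{(x,i)})(b)‖ + (|e|s)²‖w(b₊)‖κ(x,b₊)]
+ |a_k|(L^kε)^{−2}‖(G_k(Ω,X)avgSrc w)(x)‖`, `κ(x,y) = Σ_i‖(G_k(Ω,X)e_{(y,i)})(x)‖` — the dipole term in the symmetric form
`norm_propagatorK_srcDM_apply_le`.  With `X = B` this is the outer block of (1.16), with `X = A + B` the middle one. [cite: Balaban1982Higgs1, (3.16) p.615] [cite: Balaban1983Higgs3, (1.16) p.414, (2.10) p.426] -/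
theorem norm_propagatorK_srcV_apply_le {s : ℝ} (hA : ∀ b : HiggsLattice.PBond P 0, |A b| ≤ s) (w : ScalarField P 0 N)
    (x : HiggsLattice.Site P 0) :
    ‖propagatorK C Ω X msq a k (srcV C A B k Ω a w) x‖
      ≤ (∑ b : HiggsLattice.PBond P 0, if Inside Ω b then
            |C.e| * s * ‖covDeriv C B w b‖ * (∑ i : Ix N, ‖propagatorK C Ω X msq a k (cb P N 0 (b.tgt, i)) x‖)
              + |C.e| * s * ‖w b.tgt‖
                  * (∑ i : Ix N, ‖covDeriv C B (propagatorK C Ω X msq a k (cb P N 0 (x, i))) b‖)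
              + (|C.e| * s) ^ 2 * ‖w b.tgt‖ * (∑ i : Ix N, ‖propagatorK C Ω X msq a k (cb P N 0 (b.tgt, i)) x‖)
            else 0)
        + |B1.aSeq a P.L k| * (P.mesh k)⁻¹ ^ 2 * ‖propagatorK C Ω X msq a k (avgSrc C A B k w) x‖ := by
  have hε0 : 0 ≤ (P.mesh 0)⁻¹ := inv_nonneg.mpr (P.mesh_pos 0).le
  rw [map_srcV C Ω A B a k (propagatorK C Ω X msq a k) w, Pi.sub_apply, Pi.neg_apply, Pi.smul_apply,
    Finset.sum_apply]
  refine (norm_sub_le _ _).trans (add_le_add ?_ ?_)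
  · rw [norm_neg]
    refine (norm_sum_le _ _).trans (Finset.sum_le_sum fun b _ => ?_)
    split_ifs
    · rw [Pi.add_apply, Pi.add_apply, Pi.smul_apply]
      refine (norm_add_le _ _).trans (add_le_add ((norm_add_le _ _).trans (add_le_add ?_ ?_)) ?_)
      · simpa only [LinearMap.coe_comp, Function.comp_apply, LinearMap.coe_proj, Function.eval] using
          norm_mapE_srcMD_le C A B (LinearMap.proj x ∘ₗ propagatorK C Ω X msq a k) (hA b) w
      · rw [norm_smul, Real.norm_eq_abs, abs_of_nonneg hε0]
        exact norm_propagatorK_srcDM_apply_le C A B Ω X msq a k (hA b) w x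
      · simpa only [LinearMap.coe_comp, Function.comp_apply, LinearMap.coe_proj, Function.eval] using
          norm_mapE_srcMM_le C A B (LinearMap.proj x ∘ₗ propagatorK C Ω X msq a k) (hA b) w
    · rw [Pi.zero_apply, norm_zero]
  · rw [norm_smul, Real.norm_eq_abs, abs_mul, abs_of_nonneg (pow_nonneg (inv_nonneg.mpr (P.mesh_pos k).le) 2)]

end Rows

end Literature.MathematicalPhysics.QuantumFieldTheory.Balaban1983to89.B3Op116SourceForm

end
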